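import Summits.Parity.BatemanHorn.Theorems.SoloInformedErdosConstantConjecture
import Mathlib.Analysis.Complex.Exponential

/-!
# SoloInformedLocatedHeuristic — the CRT heuristic for the located root count is `((d−2)/2)·A_g·x log x + O(x)`

Solo unit `solo-Parity-informed` (ideation tier, informed mode), session 136; `PLAN.md` §101, CLAIMS C224.

For an irreducible `g ∈ ℤ[X]` of degree `d ≥ 2` the located root count
`Mid_g(x) = #{(n, e) : n ≤ x < e, e ∣ g(n), e² < |g(n)|}` (`polyLocatedRootCount`) is the only open quantity in
`∑_{n≤x} τ(|g(n)|) = 2A_g x log x + 2 Mid_g(x) + O(x)` (`SoloInformedRootCountLevel`, `SoloInformedDivisorStoreyGeneral`).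
Its CRT HEURISTIC replaces the indicator "`n` is a root of `g` modulo `e`" by its mean `ρ_g(e)/e`:

  `H_g(x) = ∑_{1≤n≤x} ∑_{x<e≤⌊√|g(n)|⌋} ρ_g(e)/e`   (`polyLocatedHeuristic`).

Main results (unconditional, elementary given the Dedekind–Landau mean value `∑_{e≤y}ρ_g(e)/e = A_g log y + O(1)` of
`SoloInformedRootCountLevel` and the logarithmic size `log|g(n)| = d log n + O(1)` of `SoloInformedPolynomialGrowth`):

* `exists_abs_polyLocatedHeuristic_sub_le` — `|H_g(x) − ((d−2)/2)·A_g·x log x| ≤ C·x` for all `x ≥ 1`;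
* `tendsto_polyLocatedHeuristic_div` — `H_g(x)/(x log x) → ((d−2)/2)·A_g`;
* `locatedRootCountAsymptotic_iff_windowRootEquidistribution` — the located-root-count conjecture
  (`LocatedRootCountAsymptotic g`, `SoloInformedErdosConstantConjecture`) is EQUIVALENT to WINDOW ROOT EQUIDISTRIBUTION
  `Mid_g(x) − H_g(x) = o(x log x)` (`WindowRootEquidistribution g`): the roots `n ≤ x` of `g` modulo the moduli `e` of the window
  `x < e ≤ √|g(n)|` — moduli LARGER than the length of the range of `n` — are, on average over the window, as numerous as the
  CRT mean predicts;
* `erdosDivisorSumAsymptotic_iff_windowRootEquidistribution` — hence Erdős's conjectured asymptotic `∑τ(|g(n)|) ~ d·A_g·x log x`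
  is equivalent to window root equidistribution, for every irreducible `g` of degree `≥ 2`.

This isolates the exact arithmetic input missing in degree `≥ 3` (equidistribution of polynomial roots to moduli beyond `x`,
a Hooley / Duke–Friedlander–Iwaniec / Tóth-type statement outside the range of those theorems), and it is the typed form of the
measured ratios `Mid/Hmid = 1.00007, 1.00104, 1.00168` at `x = 2·10⁶` for `k³+2`, `k³+3` and a cyclic cubic (numerics E2/E7/E9 of
this unit).  No sorry, no new axioms.
-/

namespace Summit.Parity.BatemanHorn.Theorems

open Finset Filter Polynomial
open scoped Topology
open Literature.NumberTheory.Sieve (polyRootCountMod)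

/-! ### Definitions -/

/-- The CRT HEURISTIC for the located root count: `H_g(x) = ∑_{1≤n≤x} ∑_{x<e≤⌊√|g(n)|⌋} ρ_g(e)/e`. -/
noncomputable def polyLocatedHeuristic (g : ℤ[X]) (x : ℕ) : ℝ :=
  ∑ n ∈ Icc 1 x, ∑ e ∈ Ioc x (Nat.sqrt (g.eval (n : ℤ)).natAbs), (polyRootCountMod ![g] e : ℝ) / e

/-- WINDOW ROOT EQUIDISTRIBUTION for `g`: `Mid_g(x) − H_g(x) = o(x log x)` — the located root count agrees with its CRT
heuristic to first order.  A `Prop` (open for every irreducible `g` of degree `≥ 3`). -/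
def WindowRootEquidistribution (g : ℤ[X]) : Prop :=
  Tendsto (fun x : ℕ => ((polyLocatedRootCount g x : ℝ) - polyLocatedHeuristic g x) / ((x : ℝ) * Real.log x))
    atTop (𝓝 0)

/-! ### Elementary lemmas -/

/-- The window sum is a difference of two levels: `∑_{x<e≤s} ρ(e)/e = L_g(max x s) − L_g(x)`. -/
theorem sum_Ioc_rootCount_div_eq_level_sub (g : ℤ[X]) (x s : ℕ) :
    ∑ e ∈ Ioc x s, (polyRootCountMod ![g] e : ℝ) / e = polySmallLevel g (max x s) - polySmallLevel g x := by
  rcases le_or_gt s x with h | h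
  · rw [Finset.Ioc_eq_empty (not_lt.mpr h), sum_empty, max_eq_left h, sub_self]
  · rw [max_eq_right h.le]
    unfold polySmallLevel
    have hU : Icc 1 s = Icc 1 x ∪ Ioc x s := by
      ext e
      simp only [mem_Icc, mem_union, mem_Ioc]
      omega
    have hD : Disjoint (Icc 1 x) (Ioc x s) := by
      rw [Finset.disjoint_left]
      intro e he he'
      rw [mem_Icc] at he
      rw [mem_Ioc] at he'
      omega
    rw [hU, sum_union hD]
    ring

/-- `2 log ⌊√N⌋ ≤ log N` for `N ≥ 1`. -/
theorem two_mul_log_sqrt_le {N : ℕ} (hN : 1 ≤ N) :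
    2 * Real.log (Nat.sqrt N : ℝ) ≤ Real.log (N : ℝ) := by
  have hs : 0 < Nat.sqrt N := Nat.sqrt_pos.mpr (by omega)
  have hss : Nat.sqrt N * Nat.sqrt N ≤ N := Nat.sqrt_le N
  have h1 : ((Nat.sqrt N : ℝ)) * (Nat.sqrt N : ℝ) ≤ (N : ℝ) := by exact_mod_cast hss
  have hspos : (0 : ℝ) < Nat.sqrt N := by exact_mod_cast hs
  have h2 := Real.log_le_log (by positivity) h1
  rw [Real.log_mul hspos.ne' hspos.ne'] at h2
  linarith

/-- `log N ≤ 2 log ⌊√N⌋ + 2 log 2` for `N ≥ 1` (as `N < (⌊√N⌋+1)² ≤ 4⌊√N⌋²`). -/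
theorem log_le_two_mul_log_sqrt_add {N : ℕ} (hN : 1 ≤ N) :
    Real.log (N : ℝ) ≤ 2 * Real.log (Nat.sqrt N : ℝ) + 2 * Real.log 2 := by
  have hs : 0 < Nat.sqrt N := Nat.sqrt_pos.mpr (by omega)
  have hlt : N < (Nat.sqrt N + 1) * (Nat.sqrt N + 1) := Nat.lt_succ_sqrt N
  have hle : (Nat.sqrt N + 1) * (Nat.sqrt N + 1) ≤ (2 * Nat.sqrt N) * (2 * Nat.sqrt N) :=
    Nat.mul_le_mul (by omega) (by omega)
  have h1 : (N : ℝ) ≤ (2 * (Nat.sqrt N : ℝ)) * (2 * (Nat.sqrt N : ℝ)) := by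
    exact_mod_cast (hlt.le.trans hle)
  have hspos : (0 : ℝ) < Nat.sqrt N := by exact_mod_cast hs
  have hNpos : (0 : ℝ) < N := by exact_mod_cast (show 0 < N by omega)
  have h2 := Real.log_le_log hNpos h1
  have h2s : (2 * (Nat.sqrt N : ℝ)) ≠ 0 := by positivity
  rw [Real.log_mul h2s h2s, Real.log_mul two_ne_zero hspos.ne'] at h2
  linarith

/-- `∑_{1≤n≤x} log n ≤ x log x`. -/
theorem sum_Icc_log_le_mul_log (x : ℕ) :
    ∑ n ∈ Icc 1 x, Real.log (n : ℝ) ≤ (x : ℝ) * Real.log x := by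
  have h : ∀ n ∈ Icc 1 x, Real.log (n : ℝ) ≤ Real.log (x : ℝ) := by
    intro n hn
    rw [mem_Icc] at hn
    exact Real.log_le_log (by exact_mod_cast hn.1) (by exact_mod_cast hn.2)
  have := Finset.sum_le_card_nsmul _ _ _ h
  rwa [Nat.card_Icc, show x + 1 - 1 = x by omega, nsmul_eq_mul] at this

/-- `x log x − x ≤ ∑_{1≤n≤x} log n` (from `x^x/x! ≤ e^x`). -/
theorem mul_log_sub_le_sum_Icc_log (x : ℕ) :
    (x : ℝ) * Real.log x - x ≤ ∑ n ∈ Icc 1 x, Real.log (n : ℝ) := by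
  have h1 : ∑ n ∈ Icc 1 x, Real.log (n : ℝ) = Real.log (x.factorial : ℝ) := by
    induction x with
    | zero => simp
    | succ k ih =>
      rw [Finset.sum_Icc_succ_top (by omega), ih, Nat.factorial_succ, Nat.cast_mul,
        Real.log_mul (by positivity) (by positivity)]
      ring
  rw [h1]
  rcases Nat.eq_zero_or_pos x with rfl | hx
  · simp
  have hf : (0 : ℝ) < (x.factorial : ℝ) := by exact_mod_cast Nat.factorial_pos x
  have h2 := Real.pow_div_factorial_le_exp (x : ℝ) (Nat.cast_nonneg x) x
  rw [div_le_iff₀ hf] at h2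
  have hxpos : (0 : ℝ) < x := Nat.cast_pos.mpr hx
  have h3 := Real.log_le_log (by positivity) h2
  rw [Real.log_pow, Real.log_mul (Real.exp_pos _).ne' hf.ne', Real.log_exp] at h3
  linarith

/-! ### The heuristic is `((d−2)/2)·A_g·x log x + O(x)` -/

/-- **The CRT heuristic, evaluated**: for an irreducible `g` of degree `d ≥ 2` there is `C` with
`|H_g(x) − ((d−2)/2)·A_g·x log x| ≤ C·x` for all `x ≥ 1`.  Ingredients: `∑_{e≤y}ρ_g(e)/e = A_g log y + O(1)`
(`exists_abs_polySmallLevel_sub_log_le`), `log|g(n)| = d log n + O(1)` (`exists_abs_log_natAbs_eval_sub_le`),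
`2 log⌊√N⌋ = log N + O(1)`, and `∑_{n≤x} log n = x log x + O(x)`. [this work] -/
theorem exists_abs_polyLocatedHeuristic_sub_le {g : ℤ[X]} (hirr : Irreducible g) (hdeg : 2 ≤ g.natDegree) :
    ∃ C : ℝ, ∀ x : ℕ, 1 ≤ x →
      |polyLocatedHeuristic g x - ((g.natDegree : ℝ) - 2) / 2 * rootLevelConst g * ((x : ℝ) * Real.log x)|
        ≤ C * x := by
  have hdeg0 : 0 < g.natDegree := by omega
  obtain ⟨K, hK⟩ := exists_abs_polySmallLevel_sub_log_le hirr hdeg0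
  obtain ⟨B, hB⟩ := exists_abs_log_natAbs_eval_sub_le hdeg0
  set A : ℝ := rootLevelConst g with hA
  set d : ℝ := (g.natDegree : ℝ) with hd
  have hd2 : (2 : ℝ) ≤ d := by rw [hd]; exact_mod_cast hdeg
  have hK0 : 0 ≤ K := le_trans (abs_nonneg _) (hK 1 le_rfl)
  have hB0 : 0 ≤ B := le_trans (abs_nonneg _) (hB 1 le_rfl)
  refine ⟨2 * K + |A| * (B / 2 + Real.log 2) + |A| + |A| * (d / 2), fun x hx => ?_⟩
  have hxpos : (0 : ℝ) < x := Nat.cast_pos.mpr (by omega)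
  have hlogx0 : 0 ≤ Real.log (x : ℝ) := Real.log_nonneg (by exact_mod_cast hx)
  -- per-`n` quantities
  set T : ℕ → ℝ := fun n => ∑ e ∈ Ioc x (Nat.sqrt (g.eval (n : ℤ)).natAbs), (polyRootCountMod ![g] e : ℝ) / e
    with hT
  set lam : ℕ → ℝ := fun n => d / 2 * Real.log (n : ℝ) - Real.log (x : ℝ) with hlam
  -- the per-`n` bound
  have hmain : ∀ n ∈ Icc 1 x,
      |T n - A * lam n| ≤ 2 * K + |A| * (B / 2 + Real.log 2) + |A| * (Real.log (x : ℝ) - Real.log (n : ℝ)) := by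
    intro n hn
    rw [mem_Icc] at hn
    have hn0 : (0 : ℝ) < n := Nat.cast_pos.mpr (by omega)
    have hlogn0 : 0 ≤ Real.log (n : ℝ) := Real.log_nonneg (by exact_mod_cast hn.1)
    have hlognx : Real.log (n : ℝ) ≤ Real.log (x : ℝ) :=
      Real.log_le_log hn0 (by exact_mod_cast hn.2)
    have hgz : g.eval (n : ℤ) ≠ 0 := eval_natCast_ne_zero_of_irreducible hirr hdeg n
    set N : ℕ := (g.eval (n : ℤ)).natAbs with hN
    have hN1 : 1 ≤ N := Nat.one_le_iff_ne_zero.mpr (Int.natAbs_ne_zero.mpr hgz)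
    set s : ℕ := Nat.sqrt N with hs
    have hs1 : 1 ≤ s := Nat.sqrt_pos.mpr (by omega)
    -- `log s = (d/2) log n + O(1)`
    have hBn := hB n hn.1
    rw [← hN] at hBn
    have hlo := two_mul_log_sqrt_le hN1
    have hhi := log_le_two_mul_log_sqrt_add hN1
    rw [← hs] at hlo hhi
    have hls_lo : d / 2 * Real.log n - B / 2 - Real.log 2 ≤ Real.log (s : ℝ) := by
      have := (abs_le.mp hBn).1
      linarith
    have hls_hi : Real.log (s : ℝ) ≤ d / 2 * Real.log n + B / 2 := by
      have := (abs_le.mp hBn).2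
      linarith
    have hTeq : T n = polySmallLevel g (max x s) - polySmallLevel g x := by
      rw [hT]
      exact sum_Ioc_rootCount_div_eq_level_sub g x s
    rcases le_or_gt s x with hsx | hxs
    · -- empty window: `T n = 0`, and `|λ_n|` is small
      have hT0 : T n = 0 := by rw [hTeq, max_eq_left hsx, sub_self]
      have hlogsx : Real.log (s : ℝ) ≤ Real.log (x : ℝ) :=
        Real.log_le_log (by exact_mod_cast (show 0 < s by omega)) (by exact_mod_cast hsx)
      have hlam_hi : lam n ≤ B / 2 + Real.log 2 := by
        simp only [hlam]; linarith
      have hlam_lo : -(Real.log (x : ℝ) - Real.log (n : ℝ)) ≤ lam n := by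
        simp only [hlam]
        have : Real.log (n : ℝ) ≤ d / 2 * Real.log n := by nlinarith
        linarith
      have hlam_abs : |lam n| ≤ B / 2 + Real.log 2 + (Real.log (x : ℝ) - Real.log (n : ℝ)) := by
        rw [abs_le]; constructor <;> nlinarith [Real.log_nonneg (show (1:ℝ) ≤ 2 by norm_num)]
      rw [hT0, zero_sub, abs_neg, abs_mul]
      have hA0 : 0 ≤ |A| := abs_nonneg A
      nlinarith [mul_le_mul_of_nonneg_left hlam_abs hA0]
    · -- window `x < e ≤ s`
      have hmax : max x s = s := max_eq_right hxs.le
      rw [hmax] at hTeq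
      have h1 := hK s hs1
      have h2 := hK x hx
      have hTA : |T n - A * (Real.log (s : ℝ) - Real.log (x : ℝ))| ≤ 2 * K := by
        rw [hTeq]
        have := abs_sub (polySmallLevel g s - A * Real.log s) (polySmallLevel g x - A * Real.log x)
        have e : polySmallLevel g s - polySmallLevel g x - A * (Real.log (s : ℝ) - Real.log (x : ℝ)) =
            (polySmallLevel g s - A * Real.log s) - (polySmallLevel g x - A * Real.log x) := by ring
        rw [e]
        linarith
      have hdiff : |(Real.log (s : ℝ) - Real.log (x : ℝ)) - lam n| ≤ B / 2 + Real.log 2 := by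
        simp only [hlam]
        rw [abs_le]; constructor <;> linarith
      have hA0 : 0 ≤ |A| := abs_nonneg A
      have e : T n - A * lam n = (T n - A * (Real.log (s : ℝ) - Real.log (x : ℝ))) +
          A * ((Real.log (s : ℝ) - Real.log (x : ℝ)) - lam n) := by ring
      rw [e]
      refine (abs_add_le _ _).trans ?_
      rw [abs_mul]
      nlinarith [mul_le_mul_of_nonneg_left hdiff hA0, mul_nonneg hA0 (sub_nonneg.mpr hlognx)]
  -- summing the per-`n` bound
  have hH : polyLocatedHeuristic g x = ∑ n ∈ Icc 1 x, T n := rfl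
  have hsum1 : |∑ n ∈ Icc 1 x, (T n - A * lam n)| ≤
      ∑ n ∈ Icc 1 x, (2 * K + |A| * (B / 2 + Real.log 2) + |A| * (Real.log (x : ℝ) - Real.log (n : ℝ))) :=
    (abs_sum_le_sum_abs _ _).trans (sum_le_sum hmain)
  have hcard : ((Icc 1 x).card : ℝ) = x := by
    rw [Nat.card_Icc]; push_cast; ring
  have hSlog_hi := sum_Icc_log_le_mul_log x
  have hSlog_lo := mul_log_sub_le_sum_Icc_log x
  -- evaluate the right-hand sum
  have hR : ∑ n ∈ Icc 1 x, (2 * K + |A| * (B / 2 + Real.log 2) + |A| * (Real.log (x : ℝ) - Real.log (n : ℝ))) =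
      (2 * K + |A| * (B / 2 + Real.log 2)) * x + |A| * ((x : ℝ) * Real.log x - ∑ n ∈ Icc 1 x, Real.log (n : ℝ)) := by
    rw [sum_add_distrib, sum_const, nsmul_eq_mul, hcard, ← mul_sum, sum_sub_distrib, sum_const, nsmul_eq_mul, hcard]
    ring
  -- evaluate `∑ (T n − A λ_n)`
  have hL : ∑ n ∈ Icc 1 x, (T n - A * lam n) =
      polyLocatedHeuristic g x - A * (d / 2 * ∑ n ∈ Icc 1 x, Real.log (n : ℝ) - (x : ℝ) * Real.log x) := by
    rw [sum_sub_distrib, ← hH, ← mul_sum]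
    simp only [hlam]
    rw [sum_sub_distrib, ← mul_sum, sum_const, nsmul_eq_mul, hcard]
  rw [hL, hR] at hsum1
  -- now combine
  have hA0 : 0 ≤ |A| := abs_nonneg A
  have hgap : |A * (d / 2 * ∑ n ∈ Icc 1 x, Real.log (n : ℝ) - (x : ℝ) * Real.log x) -
      (d - 2) / 2 * A * ((x : ℝ) * Real.log x)| ≤ |A| * (d / 2) * x := by
    have e : A * (d / 2 * ∑ n ∈ Icc 1 x, Real.log (n : ℝ) - (x : ℝ) * Real.log x) -
        (d - 2) / 2 * A * ((x : ℝ) * Real.log x) =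
        A * (d / 2) * (∑ n ∈ Icc 1 x, Real.log (n : ℝ) - (x : ℝ) * Real.log x) := by ring
    rw [e, abs_mul, abs_mul, abs_of_nonneg (by linarith : (0 : ℝ) ≤ d / 2)]
    have : |∑ n ∈ Icc 1 x, Real.log (n : ℝ) - (x : ℝ) * Real.log x| ≤ x := by
      rw [abs_le]; constructor <;> linarith
    exact mul_le_mul_of_nonneg_left this (by positivity)
  have hfinal := abs_sub_le (polyLocatedHeuristic g x)
    (A * (d / 2 * ∑ n ∈ Icc 1 x, Real.log (n : ℝ) - (x : ℝ) * Real.log x))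
    ((d - 2) / 2 * A * ((x : ℝ) * Real.log x))
  have hmid : |A| * ((x : ℝ) * Real.log x - ∑ n ∈ Icc 1 x, Real.log (n : ℝ)) ≤ |A| * x :=
    mul_le_mul_of_nonneg_left (by linarith) hA0
  nlinarith

/-- **The heuristic constant**: `H_g(x)/(x log x) → ((d−2)/2)·A_g` for every irreducible `g` of degree `d ≥ 2`. [this work] -/
theorem tendsto_polyLocatedHeuristic_div {g : ℤ[X]} (hirr : Irreducible g) (hdeg : 2 ≤ g.natDegree) :
    Tendsto (fun x : ℕ => polyLocatedHeuristic g x / ((x : ℝ) * Real.log x)) atTop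
      (𝓝 (((g.natDegree : ℝ) - 2) / 2 * rootLevelConst g)) := by
  obtain ⟨C, hC⟩ := exists_abs_polyLocatedHeuristic_sub_le hirr hdeg
  set c₀ : ℝ := ((g.natDegree : ℝ) - 2) / 2 * rootLevelConst g with hc₀
  have h0 := tendsto_div_mul_log_of_abs_le (u := fun x : ℕ =>
    polyLocatedHeuristic g x - c₀ * ((x : ℝ) * Real.log x)) (C := C) (fun x hx => hC x (by omega))
  have h1 := h0.add_const c₀
  rw [zero_add] at h1
  refine h1.congr' ?_
  filter_upwards [eventually_ge_atTop 2] with x hx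
  have hx' : (2 : ℝ) ≤ x := by exact_mod_cast hx
  have hne : (x : ℝ) * Real.log x ≠ 0 := by
    have : 0 < Real.log (x : ℝ) := Real.log_pos (by linarith)
    positivity
  rw [sub_div, mul_div_assoc, div_self hne, mul_one]
  ring

/-! ### The located-root-count conjecture is window root equidistribution -/

/-- **Located-root-count conjecture ⟺ window root equidistribution**, for every irreducible `g` of degree `≥ 2`:
`Mid_g(x)/(x log x) → ((d−2)/2)A_g` iff `Mid_g(x) − H_g(x) = o(x log x)`. [this work] -/
theorem locatedRootCountAsymptotic_iff_windowRootEquidistribution {g : ℤ[X]} (hirr : Irreducible g)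
    (hdeg : 2 ≤ g.natDegree) :
    LocatedRootCountAsymptotic g ↔ WindowRootEquidistribution g := by
  have hH := tendsto_polyLocatedHeuristic_div hirr hdeg
  unfold LocatedRootCountAsymptotic WindowRootEquidistribution
  constructor
  · intro hM
    have := hM.sub hH
    rw [sub_self] at this
    exact this.congr (fun x => by rw [sub_div])
  · intro hW
    have := hW.add hH
    rw [zero_add] at this
    exact this.congr (fun x => by rw [sub_div, sub_add_cancel])

/-- **Erdős's asymptotic ⟺ window root equidistribution**: for every irreducible `g` of degree `d ≥ 2`,
`∑_{n≤x} τ(|g(n)|) ~ d·A_g·x log x` iff `Mid_g(x) − H_g(x) = o(x log x)`. [this work] -/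
theorem erdosDivisorSumAsymptotic_iff_windowRootEquidistribution {g : ℤ[X]} (hirr : Irreducible g)
    (hdeg : 2 ≤ g.natDegree) :
    ErdosDivisorSumAsymptotic g ↔ WindowRootEquidistribution g :=
  (erdosDivisorSumAsymptotic_iff_located hirr hdeg).trans
    (locatedRootCountAsymptotic_iff_windowRootEquidistribution hirr hdeg)

/-- Degree `2`: window root equidistribution holds (the window is `O(x)` pairs wide and the heuristic is `O(x)`). -/
theorem windowRootEquidistribution_of_natDegree_eq_two {g : ℤ[X]} (hirr : Irreducible g)
    (hdeg : g.natDegree = 2) : WindowRootEquidistribution g :=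
  (locatedRootCountAsymptotic_iff_windowRootEquidistribution hirr (by omega)).mp
    (locatedRootCountAsymptotic_of_natDegree_eq_two hirr hdeg)

end Summit.Parity.BatemanHorn.Theorems
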